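import Mathlib
import Summits.PneNP.PneNP.Theorems.Nc03AvoidResidualCoreReductionEasy

/-!
# Route Nc03AvoidResidualCore, item `ResidualCoreReduction` — the `𝔽₂`-rank certificates, I: affine, all-equal, `a ∧ (b ⊕ c)`

Helper file for `stmt-PneNP-20227` (residual-core reduction of `NC⁰₃-AVOID` at linear stretch; cell
pnp-ideate, dossier HOME/pnp-ideate-p2/ROUND-3.md §2.4–2.5). For PURE instances of the NPN classes
`3` (`a ⊕ b`), `7` (`a ⊕ b ⊕ c`), `8` (all-equal) and `9` (`a ∧ (b ⊕ c)`) we prove certificate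
SOUNDNESS and EXISTENCE theorems whose conditions are memberships of explicit vectors of
`𝔽₂^N` (sums of one, two or three unit vectors attached to the outputs) in spans of such vectors —
the shape a polynomial-time search decides with a rank oracle:

* affine (`3`, `7`): the first output whose row lies in the span of the earlier rows; pattern
  `0 … 0 1` (`M > N`);
* all-equal (`8`): an output both of whose pair-rows lie in the span of the pair-rows of the other
  outputs; pattern "all `1` except this output" (`M > N`);
* `a ∧ (b ⊕ c)` (`9`): switch every head on by a `1` on its first output; the remaining outputs are
  then AFFINE in the tails, and the first of them whose tail-row depends on the earlier ones carries
  the contradiction (`M > 2N`).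

Generic tools: the `𝔽₂`-pairing of an assignment with a row (`chi`, `bit`), orthogonality to a span
(`dot_eq_zero_of_mem_span`), and the counting lemma `exists_nonnew` (more than `N` outputs ⇒ some
output has all its rows in the span of the rows of the earlier ones), proved through a leading-term
linear-independence criterion. [folklore; ROUND-3 §2.4, §2.5]
-/

set_option linter.dupNamespace false -- `Summit.PneNP.PneNP.…`: summit = sub-problem name (D-0017 single-conjunct layout)

namespace Summit.PneNP.PneNP.Theorems.Nc03Reduction

open Finset Literature.Computability.Complexity

variable {N M : ℕ}

/-! ## `𝔽₂`-vectors attached to assignments and outputs -/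

/-- Vectors of `𝔽₂^N`. -/
abbrev Vec (N : ℕ) := Fin N → ZMod 2

/-- The unit vector of a variable. -/
def ind (v : Fin N) : Vec N := fun w => if w = v then 1 else 0

/-- A bit as an element of `𝔽₂`. -/
def bit (b : Bool) : ZMod 2 := if b then 1 else 0

/-- The `𝔽₂`-vector of an assignment. -/
def chi (x : Fin N → Bool) : Vec N := fun w => bit (x w)

/-- Pairing an assignment with a unit vector reads the bit. -/
theorem chi_dot_ind (x : Fin N → Bool) (v : Fin N) : chi x ⬝ᵥ ind v = bit (x v) := by
  unfold dotProduct ind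
  rw [Finset.sum_eq_single v]
  · simp [chi]
  · intro w _ hw; simp [hw]
  · intro h; exact absurd (Finset.mem_univ v) h

/-- Two bits sum to the bit of their `xor`. -/
theorem bit_add (p q : Bool) : bit p + bit q = bit (xor p q) := by
  cases p <;> cases q <;> decide

/-- `bit` is injective. -/
theorem bit_eq_bit {p q : Bool} : bit p = bit q ↔ p = q := by
  cases p <;> cases q <;> decide

/-- `bit b = 0 ↔ b = false`. -/
theorem bit_eq_zero {p : Bool} : bit p = 0 ↔ p = false := by
  cases p <;> decide

/-- `bit b = 1 ↔ b = true`. -/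
theorem bit_eq_one {p : Bool} : bit p = 1 ↔ p = true := by
  cases p <;> decide

/-- `xor` vanishes exactly on equal bits. -/
theorem xor_eq_false_iff' {p q : Bool} : xor p q = false ↔ p = q := by
  cases p <;> cases q <;> decide

/-- Pairing with a sum of two unit vectors. -/
theorem chi_dot_pair (x : Fin N → Bool) (u v : Fin N) :
    chi x ⬝ᵥ (ind u + ind v) = bit (xor (x u) (x v)) := by
  rw [dotProduct_add, chi_dot_ind, chi_dot_ind, bit_add]

/-- Pairing with a sum of three unit vectors. -/
theorem chi_dot_trip (x : Fin N → Bool) (u v w : Fin N) :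
    chi x ⬝ᵥ (ind u + ind v + ind w) = bit (xor (xor (x u) (x v)) (x w)) := by
  rw [dotProduct_add, chi_dot_pair, chi_dot_ind, bit_add]

/-- A vector orthogonal to a set is orthogonal to its span. -/
theorem dot_eq_zero_of_mem_span (a : Vec N) {S : Set (Vec N)} (hS : ∀ s ∈ S, a ⬝ᵥ s = 0)
    {v : Vec N} (hv : v ∈ Submodule.span (ZMod 2) S) : a ⬝ᵥ v = 0 := by
  induction hv using Submodule.span_induction with
  | mem s hs => exact hS s hs
  | zero => simp
  | add u w _ _ hu hw => rw [dotProduct_add, hu, hw, add_zero]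
  | smul c u _ hu => rw [dotProduct_smul, hu, smul_zero]

/-! ## Counting: more than `N` outputs force a dependent one -/

/-- **Leading-term criterion.** If no `u e` (`e ∈ S`) lies in the span of the `u f` with `f ∈ S`,
`f < e`, then `|S| ≤ N`. [folklore] -/
theorem card_le_of_triangular (S : Finset (Fin M)) (u : Fin M → Vec N)
    (h : ∀ e ∈ S, u e ∉ Submodule.span (ZMod 2) (u '' {f | f ∈ S ∧ f < e})) : S.card ≤ N := by
  classical
  have hli : LinearIndependent (ZMod 2) (fun e : ↥S => u (e : Fin M)) := by
    rw [Fintype.linearIndependent_iff]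
    intro g hg
    by_contra hne
    push Not at hne
    obtain ⟨i₁, hi₁⟩ := hne
    set T := (Finset.univ : Finset ↥S).filter (fun i => g i ≠ 0) with hT
    have hTne : T.Nonempty := ⟨i₁, by rw [hT, Finset.mem_filter]; exact ⟨Finset.mem_univ _, hi₁⟩⟩
    obtain ⟨i₀, hi₀T, hmax⟩ := Finset.exists_max_image T (fun i => ((i : Fin M) : ℕ)) hTne
    have hg0 : g i₀ ≠ 0 := (Finset.mem_filter.1 hi₀T).2
    have hsum : g i₀ • u i₀ + ∑ j ∈ (Finset.univ : Finset ↥S).erase i₀, g j • u j = 0 := by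
      rw [Finset.add_sum_erase _ (fun j => g j • u (j : Fin M)) (Finset.mem_univ i₀)]
      exact hg
    have hui : u i₀ = (-(g i₀)⁻¹) • ∑ j ∈ (Finset.univ : Finset ↥S).erase i₀, g j • u j := by
      have h1 : g i₀ • u (i₀ : Fin M) = -∑ j ∈ (Finset.univ : Finset ↥S).erase i₀, g j • u j :=
        eq_neg_of_add_eq_zero_left hsum
      calc u (i₀ : Fin M) = (g i₀)⁻¹ • (g i₀ • u (i₀ : Fin M)) := by
            rw [smul_smul, inv_mul_cancel₀ hg0, one_smul]
        _ = _ := by rw [h1, smul_neg, neg_smul]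
    apply h i₀ i₀.2
    rw [hui]
    refine Submodule.smul_mem _ _ (Submodule.sum_mem _ fun j hj => ?_)
    by_cases hgj : g j = 0
    · rw [hgj, zero_smul]; exact Submodule.zero_mem _
    · refine Submodule.smul_mem _ _ (Submodule.subset_span ⟨j, ⟨j.2, ?_⟩, rfl⟩)
      have hjT : j ∈ T := by rw [hT, Finset.mem_filter]; exact ⟨Finset.mem_univ _, hgj⟩
      have hle := hmax j hjT
      have hne : (j : Fin M) ≠ i₀ := fun e => (Finset.mem_erase.1 hj).1 (Subtype.ext e)
      exact lt_of_le_of_ne (by exact_mod_cast hle) hne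
  have := hli.fintype_card_le_finrank
  simpa using this

/-- **More than `N` outputs force a dependent one**: if `|S| > N` and every output carries `t` rows,
some output `e ∈ S` has ALL its rows in the span of the rows of the outputs `f ∈ S`, `f < e`.
[folklore] -/
theorem exists_nonnew {t : ℕ} (S : Finset (Fin M)) (ρ : Fin M → Fin t → Vec N) (hS : N < S.card) :
    ∃ e ∈ S, ∀ i, ρ e i ∈ Submodule.span (ZMod 2) {v | ∃ f ∈ S, f < e ∧ ∃ i', v = ρ f i'} := by
  classical
  by_contra hno
  push Not at hno
  choose ι hι using hno
  -- the leading vectors `ρ e (ι e)` are triangular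
  let u : Fin M → Vec N := fun e => if he : e ∈ S then ρ e (ι e he) else 0
  have hle := card_le_of_triangular S u fun e he hmem => ?_
  · omega
  · apply hι e he
    have hu : u e = ρ e (ι e he) := by simp [u, he]
    rw [← hu]
    refine Submodule.span_mono (fun v hv => ?_) hmem
    obtain ⟨f, ⟨hfS, hfe⟩, rfl⟩ := hv
    exact ⟨f, hfS, hfe, ι f hfS, by simp [u, hfS]⟩

/-! ## Classes 3 and 7: affine outputs -/

/-- The row of an `a ⊕ b` output. -/
def row3 (I : LocalMap 3 N M) (j : Fin M) : Vec N := ind (I.vars j 0) + ind (I.vars j 1)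

/-- The row of an `a ⊕ b ⊕ c` output. -/
def row7 (I : LocalMap 3 N M) (j : Fin M) : Vec N :=
  ind (I.vars j 0) + ind (I.vars j 1) + ind (I.vars j 2)

/-- Soundness, class `3`: if the row of `k` depends on earlier rows, the pattern `0 … 0` (before
`k`), `1` (at `k`) is never attained. -/
theorem cert3_sound {I : LocalMap 3 N M} (hP : I.IsPure (rep 3)) (k : Fin M)
    (hk : row3 I k ∈ Submodule.span (ZMod 2) (row3 I '' {j | j < k})) {y : Fin M → Bool}
    (hlt : ∀ j < k, y j = false) (hyk : y k = true) : y ∉ I.range := by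
  rintro ⟨x, rfl⟩
  have horth : ∀ s ∈ row3 I '' {j | j < k}, chi x ⬝ᵥ s = 0 := by
    rintro s ⟨j, hj, rfl⟩
    have h := hlt j hj
    rw [eval_of_isPure hP] at h
    rw [row3, chi_dot_pair, bit_eq_zero]
    simpa [rep] using h
  have h0 := dot_eq_zero_of_mem_span (chi x) horth hk
  rw [row3, chi_dot_pair, bit_eq_zero] at h0
  rw [eval_of_isPure hP] at hyk
  simp only [rep] at hyk
  rw [h0] at hyk
  exact Bool.noConfusion hyk

/-- Existence, class `3`: with `M > N` some row depends on the earlier rows. -/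
theorem cert3_exists (I : LocalMap 3 N M) (hM : N < M) :
    ∃ k : Fin M, row3 I k ∈ Submodule.span (ZMod 2) (row3 I '' {j | j < k}) := by
  obtain ⟨e, -, he⟩ := exists_nonnew (t := 1) (Finset.univ : Finset (Fin M))
    (fun j _ => row3 I j) (by simpa using hM)
  refine ⟨e, Submodule.span_mono (fun v hv => ?_) (he 0)⟩
  obtain ⟨f, -, hfe, -, rfl⟩ := hv
  exact ⟨f, hfe, rfl⟩

/-- Soundness, class `7`: as for class `3` with three-variable rows. -/
theorem cert7_sound {I : LocalMap 3 N M} (hP : I.IsPure (rep 7)) (k : Fin M)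
    (hk : row7 I k ∈ Submodule.span (ZMod 2) (row7 I '' {j | j < k})) {y : Fin M → Bool}
    (hlt : ∀ j < k, y j = false) (hyk : y k = true) : y ∉ I.range := by
  rintro ⟨x, rfl⟩
  have horth : ∀ s ∈ row7 I '' {j | j < k}, chi x ⬝ᵥ s = 0 := by
    rintro s ⟨j, hj, rfl⟩
    have h := hlt j hj
    rw [eval_of_isPure hP] at h
    rw [row7, chi_dot_trip, bit_eq_zero]
    simpa [rep] using h
  have h0 := dot_eq_zero_of_mem_span (chi x) horth hk
  rw [row7, chi_dot_trip, bit_eq_zero] at h0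
  rw [eval_of_isPure hP] at hyk
  simp only [rep] at hyk
  rw [h0] at hyk
  exact Bool.noConfusion hyk

/-- Existence, class `7`: with `M > N` some row depends on the earlier rows. -/
theorem cert7_exists (I : LocalMap 3 N M) (hM : N < M) :
    ∃ k : Fin M, row7 I k ∈ Submodule.span (ZMod 2) (row7 I '' {j | j < k}) := by
  obtain ⟨e, -, he⟩ := exists_nonnew (t := 1) (Finset.univ : Finset (Fin M))
    (fun j _ => row7 I j) (by simpa using hM)
  refine ⟨e, Submodule.span_mono (fun v hv => ?_) (he 0)⟩
  obtain ⟨f, -, hfe, -, rfl⟩ := hv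
  exact ⟨f, hfe, rfl⟩

/-! ## Class 8: all-equal outputs -/

/-- The two pair-rows of an all-equal output: roles `(0,1)` and `(1,2)`. -/
def row8 (I : LocalMap 3 N M) (j : Fin M) (i : Fin 2) : Vec N :=
  if i = 0 then ind (I.vars j 0) + ind (I.vars j 1) else ind (I.vars j 1) + ind (I.vars j 2)

/-- Soundness, class `8` (`[a = b = c]`): if both pair-rows of `e` lie in the span of the pair-rows
of the other outputs, the pattern "`1` everywhere except `0` at `e`" is never attained.
[ROUND-3 §2.4, linear-algebra form] -/
theorem cert8_sound {I : LocalMap 3 N M} (hP : I.IsPure (rep 8)) (e : Fin M)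
    (he : ∀ i, row8 I e i ∈ Submodule.span (ZMod 2) {v | ∃ f, f ≠ e ∧ ∃ i', v = row8 I f i'})
    {y : Fin M → Bool} (hy : ∀ f, f ≠ e → y f = true) (hye : y e = false) : y ∉ I.range := by
  rintro ⟨x, rfl⟩
  have horth : ∀ s ∈ {v | ∃ f, f ≠ e ∧ ∃ i', v = row8 I f i'}, chi x ⬝ᵥ s = 0 := by
    rintro s ⟨f, hfe, i', rfl⟩
    have h := hy f hfe
    rw [eval_of_isPure hP] at h
    simp only [rep, Bool.and_eq_true, beq_iff_eq] at h
    unfold row8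
    split
    · rw [chi_dot_pair, bit_eq_zero, h.1, Bool.xor_self]
    · rw [chi_dot_pair, bit_eq_zero, h.2, Bool.xor_self]
  have h0 := dot_eq_zero_of_mem_span (chi x) horth (he 0)
  have h1 := dot_eq_zero_of_mem_span (chi x) horth (he 1)
  simp only [row8] at h0 h1
  simp only [Fin.isValue, ↓reduceIte, one_ne_zero] at h0 h1
  rw [chi_dot_pair, bit_eq_zero, xor_eq_false_iff'] at h0 h1
  rw [eval_of_isPure hP] at hye
  simp only [rep, h0, h1, beq_self_eq_true, Bool.and_self] at hye
  exact Bool.noConfusion hye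

/-- Existence, class `8`: with `M > N` some output has both pair-rows in the span of the EARLIER
outputs' pair-rows (hence of the other outputs'). -/
theorem cert8_exists (I : LocalMap 3 N M) (hM : N < M) :
    ∃ e : Fin M, ∀ i, row8 I e i ∈
      Submodule.span (ZMod 2) {v | ∃ f, f < e ∧ ∃ i', v = row8 I f i'} := by
  obtain ⟨e, -, he⟩ := exists_nonnew (t := 2) (Finset.univ : Finset (Fin M)) (row8 I)
    (by simpa using hM)
  refine ⟨e, fun i => Submodule.span_mono (fun v hv => ?_) (he i)⟩
  obtain ⟨f, -, hfe, i', rfl⟩ := hv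
  exact ⟨f, hfe, i', rfl⟩

/-! ## Class 9: `a ∧ (b ⊕ c)` outputs -/

/-- The outputs that are the FIRST output of their head (role-`0` variable). -/
def firsts (I : LocalMap 3 N M) : Finset (Fin M) :=
  Finset.univ.filter fun e => ∀ j, j < e → I.vars j 0 ≠ I.vars e 0

/-- Membership in `firsts`. -/
theorem mem_firsts {I : LocalMap 3 N M} {e : Fin M} :
    e ∈ firsts I ↔ ∀ j, j < e → I.vars j 0 ≠ I.vars e 0 := by
  simp [firsts]

/-- The tail-row of an output (roles `1, 2`). -/
def row9 (I : LocalMap 3 N M) (j : Fin M) : Vec N := ind (I.vars j 1) + ind (I.vars j 2)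

/-- Every head has a first output. -/
theorem exists_mem_firsts (I : LocalMap 3 N M) (j : Fin M) :
    ∃ j₀, j₀ ∈ firsts I ∧ I.vars j₀ 0 = I.vars j 0 := by
  classical
  set C := (Finset.univ : Finset (Fin M)).filter fun j' => I.vars j' 0 = I.vars j 0
  have hne : C.Nonempty := ⟨j, by simp [C]⟩
  refine ⟨C.min' hne, mem_firsts.2 fun j' hj' heq => ?_, ?_⟩
  · have hmem : j' ∈ C := by
      simp only [C, Finset.mem_filter, Finset.mem_univ, true_and]
      rw [heq]
      exact (Finset.mem_filter.1 (C.min'_mem hne)).2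
    exact absurd (C.min'_le j' hmem) (not_le.2 hj')
  · exact (Finset.mem_filter.1 (C.min'_mem hne)).2

/-- Two first outputs with the same head coincide. -/
theorem eq_of_mem_firsts {I : LocalMap 3 N M} {e e' : Fin M} (he : e ∈ firsts I)
    (he' : e' ∈ firsts I) (h : I.vars e 0 = I.vars e' 0) : e = e' := by
  rw [mem_firsts] at he he'
  rcases lt_trichotomy e e' with hlt | heq | hgt
  · exact absurd h (he' e hlt)
  · exact heq
  · exact absurd h.symm (he e' hgt)

/-- Soundness, class `9` (`a ∧ (b ⊕ c)`, head = role `0`). Pattern: `1` on every first output of a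
head, `1` on `k`, `0` elsewhere, where `k` is not first and its tail-row depends on the tail-rows of
the earlier non-first outputs. The `1`s on first outputs switch every head on; a non-first `0`-output
then says its tails are equal; so the tails of `k` are equal, contradicting the `1` at `k`.
[ROUND-3 §2.5, prefix form] -/
theorem cert9_sound {I : LocalMap 3 N M} (hP : I.IsPure (rep 9)) (k : Fin M)
    (hdep : row9 I k ∈ Submodule.span (ZMod 2) (row9 I '' {j | j < k ∧ j ∉ firsts I}))
    {y : Fin M → Bool} (hy : ∀ j, y j = true ↔ (j ∈ firsts I ∨ j = k)) : y ∉ I.range := by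
  rintro ⟨x, hx⟩
  -- every head is on
  have hon : ∀ j, x (I.vars j 0) = true := by
    intro j
    obtain ⟨j₀, hj₀, hhead⟩ := exists_mem_firsts I j
    have h := (hy j₀).2 (Or.inl hj₀)
    rw [← hx, eval_of_isPure hP] at h
    simp only [rep, Bool.and_eq_true] at h
    rw [← hhead]; exact h.1
  have horth : ∀ s ∈ row9 I '' {j | j < k ∧ j ∉ firsts I}, chi x ⬝ᵥ s = 0 := by
    rintro s ⟨j, ⟨hjk, hjF⟩, rfl⟩
    have hyj : y j = false := by
      have := hy j
      rcases hyj : y j with _ | _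
      · rfl
      · rcases this.1 hyj with h | h
        · exact absurd h hjF
        · exact absurd h (ne_of_lt hjk)
    rw [← hx, eval_of_isPure hP] at hyj
    simp only [rep, hon j, Bool.true_and] at hyj
    rw [row9, chi_dot_pair, bit_eq_zero, hyj]
  have h0 := dot_eq_zero_of_mem_span (chi x) horth hdep
  rw [row9, chi_dot_pair, bit_eq_zero] at h0
  have hyk := (hy k).2 (Or.inr rfl)
  rw [← hx, eval_of_isPure hP] at hyk
  simp only [rep, h0, Bool.and_false] at hyk
  exact Bool.noConfusion hyk

/-- At most `N` outputs are first. -/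
theorem card_firsts_le (I : LocalMap 3 N M) : (firsts I).card ≤ N := by
  classical
  have hinj : Set.InjOn (fun j => I.vars j 0) ↑(firsts I) :=
    fun e he e' he' h => eq_of_mem_firsts he he' h
  have := Finset.card_le_card_of_injOn (fun j => I.vars j 0) (fun _ _ => Finset.mem_univ _) hinj
  simpa using this

/-- Existence, class `9`: with `M > 2N` the pattern of `cert9_sound` exists. -/
theorem cert9_exists (I : LocalMap 3 N M) (hM : 2 * N < M) :
    ∃ k : Fin M, k ∉ firsts I ∧
      row9 I k ∈ Submodule.span (ZMod 2) (row9 I '' {j | j < k ∧ j ∉ firsts I}) := by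
  classical
  have hS : N < ((Finset.univ : Finset (Fin M)).filter fun j => j ∉ firsts I).card := by
    have hsplit := Finset.card_filter_add_card_filter_not
      (s := (Finset.univ : Finset (Fin M))) (fun j => j ∈ firsts I)
    have hF := card_firsts_le I
    have hfe : (Finset.univ : Finset (Fin M)).filter (fun j => j ∈ firsts I) = firsts I := by
      ext j; simp
    rw [hfe] at hsplit
    simp only [Finset.card_univ, Fintype.card_fin] at hsplit
    omega
  obtain ⟨e, heS, he⟩ := exists_nonnew (t := 1) _ (fun j _ => row9 I j) hS
  refine ⟨e, (Finset.mem_filter.1 heS).2, Submodule.span_mono (fun v hv => ?_) (he 0)⟩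
  obtain ⟨f, hfS, hfe, -, rfl⟩ := hv
  exact ⟨f, ⟨hfe, (Finset.mem_filter.1 hfS).2⟩, rfl⟩

end Summit.PneNP.PneNP.Theorems.Nc03Reduction
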